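import Summits.Ventures.LatticeQCDFlow.Exactness.StdGaussianWedgeProbabilities
import Summits.Ventures.LatticeQCDFlow.Exactness.Phi4HMCFluctuationRelation
import Summits.Ventures.LatticeQCDFlow.Scoring.FreeFieldUnadjustedLeapfrog
import HarnessLib

/-!
# The exact free-field check of the HMC arm's acceptance column: `N` leapfrog steps on one Gaussian
# mode are accepted with probability EXACTLY `ā = 1 − (2/π)·arctan √(⟨ΔH⟩/2)`
# (`= (2/π)·arctan(8√(1 − δ²Ω²/4)/(δ²Ω²|sin Nθ|))`; one step: `(2/π)·arctan(8/(δΩ)³)`)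

HONEST FRAMING: exact (Metropolis-corrected) sampling algorithms for lattice gauge theory;
figures of merit are autocorrelation/cost numbers at stated couplings and volumes; no
continuum-physics claim.  (SCALAR calibration rung S0-A: not a gauge result.)

Venture `LatticeQCDFlow` (cell pub-lqcd), topic `Exactness`; FANOUT row 2 (`s0-phi4`, HMC arm; the
battery's "exact free-field limit check").  NEW WORK of the cell.  It closes the item that row 2's
`Scoring/FreeFieldLeapfrogEquilibriumEnergy` leaves open in so many words («NOT CLAIMED: the acceptance
formula itself»): that file computes the mode's mean energy violation
`⟨ΔH⟩ = δ⁴Ω⁴ sin²(Nθ)/(32(1 − δ²Ω²/4))` exactly; this one computes the ACCEPTANCE exactly, and the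
two combine into one universal curve.  Ingredients, all the tree's: `Scoring/FreeFieldLeapfrog`
(`lfMode`, the exact energy violation `H_N − H_0 = (δ²Ω²/8)(P_N² − P_0²)`, the rotation form
`P_N = −(sin Nθ/β)O + cos(Nθ)P`), `Scoring/FreeFieldUnadjustedLeapfrog` (Liouville for `lfMode`,
`β² = (1 − δ²Ω²/4)/Ω²`), `Phi4HMCFluctuationRelation` (`acc = P(ΔH ≤ 0) + P(ΔH < 0)` for every
measure-preserving involution), and this session's `StdGaussianWedgeProbabilities` (two-line wedge
probabilities of `N(0,1) ⊗ N(0,1)`, from row 13's cone lemma).  Nothing is cited as a fact; no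
definition.  Printed counterparts NAMED ONLY: Kennedy–Pendleton 1991 (free-field HMC acceptance
asymptotics), Gupta–Irbäck–Karsch–Petersson 1990 (`erfc(½√⟨ΔH⟩)` under a Gaussian model of `ΔH`).

ROUTE.  `Ψ_N = flip ∘ lfMode^N` is a Lebesgue-preserving involution of the `(O, P)` plane (time
reversibility `L F L = F` ⟸ `det L = 1`); with `e^{−H} = N(0,1/Ω²)(O)·N(0,1)(P)` its violation is
`(δ²Ω²/8)(P_N² − P²)`, so `acc = P(P_N² ≤ P²) + P(P_N² < P²)`; standardising `O = Z₁/Ω`,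
`P_N ∓ P = kZ₁ + (cos Nθ ∓ 1)Z₂` with `k² = sin²(Nθ)/(1 − δ²Ω²/4)`, and `{P_N² < P²}` is the double
wedge between two lines on opposite sides of the axis, of probability
`(arctan((1 − cos)/|k|) + arctan((1 + cos)/|k|))/π`; the two arctangents add
(`x·y = 1 − δ²Ω²/4 < 1`) to `arctan(8√(1 − δ²Ω²/4)/(δ²Ω²|sin Nθ|))`, whose argument is `√(2/⟨ΔH⟩)`.

## What is proved (`Ω² = w2 : ℝ≥0`, `w2 ≠ 0`; `0 < δ`, `δ²Ω² < 4`; `θ = arccos(1 − δ²Ω²/2)`)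

* §1 `measurePreserving_momentumFlip`, `measurePreserving_modeProposal`, `measurable_modeProposal`,
  **`lfMode_flip_lfMode`** (time reversibility of one step), `lfMode_iterate_flip_iterate`,
  **`modeProposal_involutive`**;
* §2 `deltaH_modeProposal_eq` — `ΔH = (δ²Ω²/8)(P_N² − P²)` for `e^{−H} = p_{1/Ω²}(O) p_1(P)`;
* §3 **`freeModeHMC_meanAccept`** — for `sin(Nθ) ≠ 0`:
  `∫∫ min(1, e^{−ΔH}) dN(0,1/Ω²)(O) dN(0,1)(P) = (2/π)·arctan(8√(1 − δ²Ω²/4)/(δ²Ω²·|sin Nθ|))`;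
* §4 **`freeModeHMC_meanAccept_eq_meanEnergyViolation`** — `= 1 − (2/π)·arctan √(m/2)`,
  `m = δ⁴Ω⁴ sin²(Nθ)/(32(1 − δ²Ω²/4))` (`= ⟨ΔH⟩`); **`freeModeHMC_meanAccept_one_step`** —
  `N = 1`: `ā = (2/π)·arctan(8/(δ³(√Ω²)³))` (unconditionally in the stable regime);
  `freeModeHMC_meanAccept_resonant` — `sin(Nθ) = 0`: `ΔH ≡ 0`, the integral is `1`.

Reading for S0-A (no numerics implied beyond displayed constants): a certified per-mode test value for
the HMC column at `λ = 0`; as a function of the measured `m = ⟨ΔH⟩` the exact one-mode acceptance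
`1 − (2/π)·arctan √(m/2) = 1 − 0.450√m + O(m^{3/2})` lies ABOVE the Gaussian-model value
`erfc(½√m) = 1 − 0.564√m + O(m)` and above the model-free Pinsker floor `1 − 0.707√m` — on one mode
`ΔH` is a product of two Gaussians, not a Gaussian; the Gaussian model is the many-mode limit.  The
resonant lengths `sin(Nθ) = 0` give `ΔH ≡ 0`, `ā = 1` (§4; cf. `FreeFieldHMCResonance`).
NOT CLAIMED: several modes (the sign set of `Σ_k (δ²Ω_k²/8)(P_{N,k}² − P_k²)` has no closed form;
the tree's involution floors apply), `λ > 0`, any value for any run.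
-/

namespace Summit.Ventures.LatticeQCDFlow.Exactness

open Real MeasureTheory ProbabilityTheory Filter Set
open Summit.Ventures.LatticeQCDFlow.Scoring
open scoped NNReal ENNReal

section ModeHMC

/-! ## §1 The one-mode HMC proposal `flip ∘ lfMode^N` is a volume-preserving involution -/

/-- The momentum flip preserves Lebesgue measure. -/
theorem measurePreserving_momentumFlip :
    MeasurePreserving (fun q : ℝ × ℝ => (q.1, -q.2))
      ((volume : Measure ℝ).prod volume) ((volume : Measure ℝ).prod volume) := by
  have hgm : Measurable (Function.uncurry fun (_ : ℝ) (y : ℝ) => -y) := measurable_snd.neg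
  exact MeasurePreserving.skew_product (μc := (volume : Measure ℝ)) (μd := (volume : Measure ℝ))
    (MeasurePreserving.id _) hgm
    (Eventually.of_forall fun _ => (Measure.measurePreserving_neg (volume : Measure ℝ)).map_eq)

/-- **The trajectory-and-flip proposal `Ψ_N = flip ∘ lfMode^N` preserves area.** -/
theorem measurePreserving_modeProposal (δ w2 : ℝ) (N : ℕ) :
    MeasurePreserving (fun z : ℝ × ℝ => (((lfMode δ w2)^[N] z).1, -((lfMode δ w2)^[N] z).2))
      ((volume : Measure ℝ).prod volume) ((volume : Measure ℝ).prod volume) :=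
  measurePreserving_momentumFlip.comp (measurePreserving_lfMode_iterate δ w2 N)

/-- `Ψ_N` is measurable. -/
theorem measurable_modeProposal (δ w2 : ℝ) (N : ℕ) :
    Measurable (fun z : ℝ × ℝ => (((lfMode δ w2)^[N] z).1, -((lfMode δ w2)^[N] z).2)) :=
  (measurable_fst.comp ((measurable_lfMode δ w2).iterate N)).prodMk
    (measurable_snd.comp ((measurable_lfMode δ w2).iterate N)).neg

/-- **Time reversibility of one leapfrog step**: `lfMode (flip (lfMode z)) = flip z`
(the matrix identity `L F L = F`, equivalent to `det L = 1`). -/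
theorem lfMode_flip_lfMode (δ w2 : ℝ) (z : ℝ × ℝ) :
    lfMode δ w2 ((lfMode δ w2 z).1, -(lfMode δ w2 z).2) = (z.1, -z.2) := by
  have hdet := lfMode_det δ w2
  simp only [lfMode]
  ext
  · linear_combination (z.1) * hdet
  · linear_combination (-z.2) * hdet

/-- Time reversibility of the trajectory: `lfMode^N (flip (lfMode^N z)) = flip z`. -/
theorem lfMode_iterate_flip_iterate (δ w2 : ℝ) (N : ℕ) (z : ℝ × ℝ) :
    (lfMode δ w2)^[N] (((lfMode δ w2)^[N] z).1, -((lfMode δ w2)^[N] z).2) = (z.1, -z.2) := by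
  induction N generalizing z with
  | zero => simp
  | succ N ih =>
      have h1 : (lfMode δ w2)^[N + 1] z = lfMode δ w2 ((lfMode δ w2)^[N] z) :=
        Function.iterate_succ_apply' _ _ _
      rw [h1, Function.iterate_succ_apply, lfMode_flip_lfMode, ih]

/-- **`Ψ_N` is an involution.** -/
theorem modeProposal_involutive (δ w2 : ℝ) (N : ℕ) :
    Function.Involutive (fun z : ℝ × ℝ => (((lfMode δ w2)^[N] z).1, -((lfMode δ w2)^[N] z).2)) := by
  intro z
  simp only
  rw [lfMode_iterate_flip_iterate]
  simp

/-! ## §2 The energy violation of the trajectory and its sign -/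

variable {w2 : ℝ≥0}

/-- With `H(O, P) = −log p_{1/Ω²}(O) − log p_1(P)` (`e^{−H}` = the mode's normalised Gibbs density
`N(0, 1/Ω²) ⊗ N(0, 1)`), the violation of `Ψ_N` is the trajectory's energy change:
`ΔH = (Ω²O_N² + P_N²)/2 − (Ω²O² + P²)/2 = (δ²Ω²/8)(P_N² − P²)` (`FreeFieldLeapfrog`). -/
theorem deltaH_modeProposal_eq (hw : w2 ≠ 0) (δ : ℝ) (N : ℕ) (z : ℝ × ℝ) :
    deltaH (fun q : ℝ × ℝ => -Real.log (gaussianPDFReal 0 w2⁻¹ q.1) - Real.log (gaussianPDFReal 0 1 q.2))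
        (fun q => (((lfMode δ w2)^[N] q).1, -((lfMode δ w2)^[N] q).2)) z
      = δ ^ 2 * (w2 : ℝ) / 8 * (((lfMode δ w2)^[N] z).2 ^ 2 - z.2 ^ 2) := by
  have hw' : (w2 : ℝ) ≠ 0 := NNReal.coe_ne_zero.mpr hw
  rw [← lfMode_iterate_energy_violation]
  unfold deltaH
  simp only [gaussianPDFReal_def, sub_zero, NNReal.coe_inv, NNReal.coe_one, mul_one]
  have hpos1 : 0 < Real.sqrt (2 * π * ((w2 : ℝ))⁻¹) := Real.sqrt_pos.mpr (by positivity)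
  have hpos2 : 0 < Real.sqrt (2 * π) := Real.sqrt_pos.mpr (by positivity)
  rw [Real.log_mul (inv_ne_zero hpos1.ne') (Real.exp_pos _).ne',
    Real.log_mul (inv_ne_zero hpos2.ne') (Real.exp_pos _).ne',
    Real.log_mul (inv_ne_zero hpos1.ne') (Real.exp_pos _).ne',
    Real.log_mul (inv_ne_zero hpos2.ne') (Real.exp_pos _).ne',
    Real.log_exp, Real.log_exp, Real.log_exp, Real.log_exp]
  field_simp
  ring

/-- The arctangent bookkeeping of the two wedge angles (pure real analysis):
`arctan((1−c)√v/S) + arctan((1+c)√v/S) = arctan(2√v/(S(1−v)))` for `S² = 1 − c²`, `S > 0`, `0 < v < 1`. -/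
private theorem arctan_wedge_sum {c S v : ℝ} (hS : 0 < S) (hS2 : S ^ 2 = 1 - c ^ 2) (hv0 : 0 < v)
    (hv1 : v < 1) :
    Real.arctan (-(c - 1) / (S / Real.sqrt v)) + Real.arctan ((c + 1) / (S / Real.sqrt v))
      = Real.arctan (2 * Real.sqrt v / (S * (1 - v))) := by
  have hr : 0 < Real.sqrt v := Real.sqrt_pos.mpr hv0
  have hr2 : Real.sqrt v ^ 2 = v := Real.sq_sqrt hv0.le
  have hxy : -(c - 1) / (S / Real.sqrt v) * ((c + 1) / (S / Real.sqrt v)) = v := by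
    rw [show -(c - 1) / (S / Real.sqrt v) * ((c + 1) / (S / Real.sqrt v))
        = (1 - c ^ 2) * Real.sqrt v ^ 2 / S ^ 2 by field_simp; ring, hr2, ← hS2]
    field_simp
  rw [Real.arctan_add (by rw [hxy]; exact hv1), hxy]
  congr 1
  field_simp
  ring

/-- Arithmetic of the final constant (pure reals). -/
private theorem wedge_constant {S r δ w : ℝ} (hS : S ≠ 0) (hδ : δ ≠ 0) (hw : w ≠ 0) :
    2 * r / (S * (δ ^ 2 * w / 4)) = 8 * r / (δ ^ 2 * w * S) := by
  field_simp
  ring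

/-! ## §3 The acceptance law -/

-- RN-23 (7)(b): the composition below elaborates close to the default budget on the farm; 400k margin.
set_option maxHeartbeats 400000 in
/-- **THE EXACT ACCEPTANCE OF HMC ON ONE FREE-FIELD MODE**: target `N(0, 1/Ω²) ⊗ N(0, 1)` on
`(O, P)`, proposal = `N` qpq-leapfrog steps of size `δ` and a momentum flip, stable regime
`δ²Ω² < 4`, `sin(Nθ) ≠ 0` (`cos θ = 1 − δ²Ω²/2`); then in equilibrium
`∫∫ min(1, e^{−ΔH}) dN(0,1/Ω²)(O) dN(0,1)(P) = (2/π)·arctan( 8√(1 − δ²Ω²/4) / (δ²Ω²·|sin Nθ|) )`. -/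
theorem freeModeHMC_meanAccept (hw : w2 ≠ 0) {δ : ℝ} (hδ : 0 < δ) (hst : δ ^ 2 * (w2 : ℝ) < 4) (N : ℕ)
    (hsin : Real.sin (N * Real.arccos (1 - δ ^ 2 * (w2 : ℝ) / 2)) ≠ 0) :
    ∫ z : ℝ × ℝ, min 1 (Real.exp (-(δ ^ 2 * (w2 : ℝ) / 8 * (((lfMode δ w2)^[N] z).2 ^ 2 - z.2 ^ 2))))
        * (gaussianPDFReal 0 w2⁻¹ z.1 * gaussianPDFReal 0 1 z.2) ∂((volume : Measure ℝ).prod volume)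
      = 2 / π * Real.arctan (8 * Real.sqrt (1 - δ ^ 2 * w2 / 4)
          / (δ ^ 2 * w2 * |Real.sin (N * Real.arccos (1 - δ ^ 2 * (w2 : ℝ) / 2))|)) := by
  have hw' : (0 : ℝ) < w2 := by exact_mod_cast pos_iff_ne_zero.mpr hw
  have hwinv : w2⁻¹ ≠ 0 := inv_ne_zero hw
  -- name the angle, the momentum coefficient and the shadow factor WITHOUT let-values
  obtain ⟨θ, hθ⟩ : ∃ θ : ℝ, Real.arccos (1 - δ ^ 2 * (w2 : ℝ) / 2) = θ := ⟨_, rfl⟩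
  obtain ⟨sv, hsv⟩ : ∃ sv : ℝ, 1 - δ ^ 2 * (w2 : ℝ) / 4 = sv := ⟨_, rfl⟩
  obtain ⟨β, hβ⟩ : ∃ β : ℝ, δ * sv / Real.sin θ = β := ⟨_, rfl⟩
  rw [hθ] at hsin ⊢
  rw [hsv]
  have hsv0 : 0 < sv := by rw [← hsv]; nlinarith
  have hsv1 : sv < 1 := by
    rw [← hsv]
    have : 0 < δ ^ 2 * (w2 : ℝ) := by positivity
    linarith
  -- Step 1: the involution framework gives `acc = P(ΔH ≤ 0) + P(ΔH < 0)`
  have hHm : Measurable (fun q : ℝ × ℝ =>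
      -Real.log (gaussianPDFReal 0 w2⁻¹ q.1) - Real.log (gaussianPDFReal 0 1 q.2)) :=
    ((Real.measurable_log.comp ((measurable_gaussianPDFReal 0 w2⁻¹).comp measurable_fst)).neg).sub
      (Real.measurable_log.comp ((measurable_gaussianPDFReal 0 1).comp measurable_snd))
  have hexp : Integrable (fun q : ℝ × ℝ =>
      Real.exp (-(-Real.log (gaussianPDFReal 0 w2⁻¹ q.1) - Real.log (gaussianPDFReal 0 1 q.2))))
      ((volume : Measure ℝ).prod volume) := by
    have h : Integrable (fun q : ℝ × ℝ => gaussianPDFReal 0 w2⁻¹ q.1 * gaussianPDFReal 0 1 q.2)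
        ((volume : Measure ℝ).prod volume) :=
      (integrable_gaussianPDFReal 0 w2⁻¹).mul_prod (integrable_gaussianPDFReal 0 1)
    exact h.congr (Eventually.of_forall fun q => (exp_neg_rwEnergy one_ne_zero hwinv q).symm)
  have hacc := acceptance_integral_eq hHm (measurable_modeProposal δ w2 N) (modeProposal_involutive δ w2 N)
    (measurePreserving_modeProposal δ w2 N) hexp
  simp only [deltaH_modeProposal_eq hw δ N, exp_neg_rwEnergy one_ne_zero hwinv] at hacc
  rw [hacc]
  -- Step 2: the rotation form of the final momentum, `P_N = −(sin Nθ/β) O + cos(Nθ) P`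
  have hrot : ∀ z : ℝ × ℝ, ((lfMode δ w2)^[N] z).2
      = -(Real.sin (N * θ) / β) * z.1 + Real.cos (N * θ) * z.2 := by
    intro z
    have h := congrArg Prod.snd (lfMode_iterate_rotation δ w2 hδ hw' hst z N)
    simp only [hθ, hsv, hβ] at h
    exact h
  have hβ2 : β ^ 2 = sv / w2 := by
    rw [← hβ, ← hsv, ← hθ, rotation_beta_sq hδ.ne' hw' hst, shadowVariance_eq hw'.ne']
  have hβ0 : β ≠ 0 := by
    intro h; rw [h] at hβ2; have : 0 < sv / w2 := div_pos hsv0 hw'; nlinarith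
  obtain ⟨k, hk⟩ : ∃ k : ℝ, -(Real.sin (N * θ) / β) * Real.sqrt ((w2⁻¹ : ℝ≥0) : ℝ) = k := ⟨_, rfl⟩
  have hsw : Real.sqrt ((w2⁻¹ : ℝ≥0) : ℝ) ^ 2 = (w2 : ℝ)⁻¹ := by
    rw [NNReal.coe_inv, Real.sq_sqrt (inv_nonneg.mpr hw'.le)]
  have hk2 : k ^ 2 = Real.sin (N * θ) ^ 2 / sv := by
    rw [← hk, mul_pow, neg_pow_two, div_pow, hsw, hβ2]
    field_simp
  have hk0 : k ≠ 0 := by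
    intro h
    rw [h] at hk2
    have : 0 < Real.sin (N * θ) ^ 2 / sv := div_pos (by positivity) hsv0
    nlinarith
  have hkabs : |k| = |Real.sin (N * θ)| / Real.sqrt sv := by
    rw [← Real.sqrt_sq_eq_abs, hk2, Real.sqrt_div (sq_nonneg _), Real.sqrt_sq_eq_abs]
  have hcos1 : Real.cos (N * θ) - 1 < 0 := by
    have h1 : Real.cos (N * θ) ≤ 1 := Real.cos_le_one _
    rcases h1.lt_or_eq with h | h
    · linarith
    · exfalso; apply hsin
      have := Real.sin_sq_add_cos_sq (N * θ)
      rw [h] at this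
      nlinarith [sq_nonneg (Real.sin (N * θ))]
  have hcos2 : 0 < Real.cos (N * θ) + 1 := by
    have h1 : -1 ≤ Real.cos (N * θ) := Real.neg_one_le_cos _
    rcases h1.lt_or_eq with h | h
    · linarith
    · exfalso; apply hsin
      have := Real.sin_sq_add_cos_sq (N * θ)
      rw [← h] at this
      nlinarith [sq_nonneg (Real.sin (N * θ))]
  -- Step 3: the two sign events as sets, and their weighted integrals as probabilities
  have hc8 : 0 < δ ^ 2 * (w2 : ℝ) / 8 := by positivity
  have hf : Measurable fun z : ℝ × ℝ => δ ^ 2 * (w2 : ℝ) / 8 * (((lfMode δ w2)^[N] z).2 ^ 2 - z.2 ^ 2) :=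
    (((measurable_snd.comp ((measurable_lfMode δ w2).iterate N)).pow_const 2).sub
      (measurable_snd.pow_const 2)).const_mul _
  have hElem : MeasurableSet {z : ℝ × ℝ | δ ^ 2 * (w2 : ℝ) / 8 * (((lfMode δ w2)^[N] z).2 ^ 2 - z.2 ^ 2) ≤ 0} :=
    measurableSet_le hf measurable_const
  have hEltm : MeasurableSet {z : ℝ × ℝ | δ ^ 2 * (w2 : ℝ) / 8 * (((lfMode δ w2)^[N] z).2 ^ 2 - z.2 ^ 2) < 0} :=
    measurableSet_lt hf measurable_const
  rw [show (fun z : ℝ × ℝ => (if δ ^ 2 * (w2 : ℝ) / 8 * (((lfMode δ w2)^[N] z).2 ^ 2 - z.2 ^ 2) ≤ 0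
        then (1 : ℝ) else 0) * (gaussianPDFReal 0 w2⁻¹ z.1 * gaussianPDFReal 0 1 z.2))
      = fun z => (if z ∈ {z : ℝ × ℝ | δ ^ 2 * (w2 : ℝ) / 8 * (((lfMode δ w2)^[N] z).2 ^ 2 - z.2 ^ 2) ≤ 0}
        then (1 : ℝ) else 0) * (gaussianPDFReal 0 w2⁻¹ z.1 * gaussianPDFReal 0 1 z.2) from rfl,
    show (fun z : ℝ × ℝ => (if δ ^ 2 * (w2 : ℝ) / 8 * (((lfMode δ w2)^[N] z).2 ^ 2 - z.2 ^ 2) < 0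
        then (1 : ℝ) else 0) * (gaussianPDFReal 0 w2⁻¹ z.1 * gaussianPDFReal 0 1 z.2))
      = fun z => (if z ∈ {z : ℝ × ℝ | δ ^ 2 * (w2 : ℝ) / 8 * (((lfMode δ w2)^[N] z).2 ^ 2 - z.2 ^ 2) < 0}
        then (1 : ℝ) else 0) * (gaussianPDFReal 0 w2⁻¹ z.1 * gaussianPDFReal 0 1 z.2) from rfl,
    integral_ite_mul_stepTarget_prod hwinv one_ne_zero hElem,
    integral_ite_mul_stepTarget_prod hwinv one_ne_zero hEltm,
    ← measureReal_def, ← measureReal_def, stepTarget_prod_eq_map w2⁻¹ 1,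
    map_measureReal_apply ((measurable_const_mul _).prodMap (measurable_const_mul _)) hElem,
    map_measureReal_apply ((measurable_const_mul _).prodMap (measurable_const_mul _)) hEltm]
  -- Step 4: pulled back to the standard pair the events are the two-line wedge (and its closure)
  have hquad : ∀ z : ℝ × ℝ,
      δ ^ 2 * (w2 : ℝ) / 8 * (((lfMode δ w2)^[N] (Real.sqrt ((w2⁻¹ : ℝ≥0) : ℝ) * z.1,
        Real.sqrt ((1 : ℝ≥0) : ℝ) * z.2)).2 ^ 2 - (Real.sqrt ((1 : ℝ≥0) : ℝ) * z.2) ^ 2)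
      = δ ^ 2 * (w2 : ℝ) / 8
        * ((k * z.1 + (Real.cos (N * θ) - 1) * z.2) * (k * z.1 + (Real.cos (N * θ) + 1) * z.2)) := by
    intro z
    rw [hrot, ← hk]
    simp only [NNReal.coe_one, Real.sqrt_one, one_mul]
    ring
  have hpre_lt : (Prod.map (fun x : ℝ => Real.sqrt ((w2⁻¹ : ℝ≥0) : ℝ) * x)
      (fun x : ℝ => Real.sqrt ((1 : ℝ≥0) : ℝ) * x)) ⁻¹'
        {z : ℝ × ℝ | δ ^ 2 * (w2 : ℝ) / 8 * (((lfMode δ w2)^[N] z).2 ^ 2 - z.2 ^ 2) < 0}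
      = {z | (k * z.1 + (Real.cos (N * θ) - 1) * z.2) * (k * z.1 + (Real.cos (N * θ) + 1) * z.2) < 0} := by
    ext z
    simp only [mem_preimage, Prod.map, mem_setOf_eq, hquad z]
    constructor
    · intro h; nlinarith [h, hc8]
    · intro h; nlinarith [h, hc8]
  have hpre_le : (Prod.map (fun x : ℝ => Real.sqrt ((w2⁻¹ : ℝ≥0) : ℝ) * x)
      (fun x : ℝ => Real.sqrt ((1 : ℝ≥0) : ℝ) * x)) ⁻¹'
        {z : ℝ × ℝ | δ ^ 2 * (w2 : ℝ) / 8 * (((lfMode δ w2)^[N] z).2 ^ 2 - z.2 ^ 2) ≤ 0}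
      = {z | (k * z.1 + (Real.cos (N * θ) - 1) * z.2) * (k * z.1 + (Real.cos (N * θ) + 1) * z.2) ≤ 0} := by
    ext z
    simp only [mem_preimage, Prod.map, mem_setOf_eq, hquad z]
    constructor
    · intro h; nlinarith [h, hc8]
    · intro h; nlinarith [h, hc8]
  rw [hpre_lt, hpre_le, stdGaussianProd_real_twoLineWedge_le_eq_lt hk0 hcos1.ne hcos2.ne', ← two_mul,
    stdGaussianProd_real_twoLineWedge' hk0 hcos1 hcos2, hkabs]
  -- Step 5: add the two wedge angles
  have hsin2 : |Real.sin (N * θ)| ^ 2 = 1 - Real.cos (N * θ) ^ 2 := by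
    rw [sq_abs]; have := Real.sin_sq_add_cos_sq (N * θ); linarith
  rw [arctan_wedge_sum (abs_pos.mpr hsin) hsin2 hsv0 hsv1]
  have h4 : 1 - sv = δ ^ 2 * w2 / 4 := by rw [← hsv]; ring
  rw [h4, wedge_constant (abs_pos.mpr hsin).ne' hδ.ne' hw'.ne']
  ring

/-! ## §4 The law in the mean energy violation: `ā = 1 − (2/π)·arctan √(⟨ΔH⟩/2)` -/

/-- **UNIVERSAL FORM IN `⟨ΔH⟩`.**  With the mode's exact mean energy violation
`m = ⟨ΔH⟩ = δ⁴Ω⁴ sin²(Nθ)/(32(1 − δ²Ω²/4))` (`Scoring/FreeFieldLeapfrogEquilibriumEnergy`), the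
acceptance of §3 reads `ā = 1 − (2/π)·arctan √(m/2)` — one curve for every step size, trajectory
length and frequency, and the same curve as the Gaussian-step site update in ITS `⟨ΔS⟩`
(`GaussianMetropolisSiteAcceptance`); beside it: the Gaussian model `erfc(√m/2)`, Pinsker `1 − √(m/2)`. -/
theorem freeModeHMC_meanAccept_eq_meanEnergyViolation (hw : w2 ≠ 0) {δ : ℝ} (hδ : 0 < δ)
    (hst : δ ^ 2 * (w2 : ℝ) < 4) (N : ℕ)
    (hsin : Real.sin (N * Real.arccos (1 - δ ^ 2 * (w2 : ℝ) / 2)) ≠ 0) :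
    ∫ z : ℝ × ℝ, min 1 (Real.exp (-(δ ^ 2 * (w2 : ℝ) / 8 * (((lfMode δ w2)^[N] z).2 ^ 2 - z.2 ^ 2))))
        * (gaussianPDFReal 0 w2⁻¹ z.1 * gaussianPDFReal 0 1 z.2) ∂((volume : Measure ℝ).prod volume)
      = 1 - 2 / π * Real.arctan (Real.sqrt
          ((δ ^ 4 * (w2 : ℝ) ^ 2 * Real.sin (N * Real.arccos (1 - δ ^ 2 * (w2 : ℝ) / 2)) ^ 2
            / (32 * (1 - δ ^ 2 * w2 / 4))) / 2)) := by
  have hw' : (0 : ℝ) < w2 := by exact_mod_cast pos_iff_ne_zero.mpr hw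
  rw [freeModeHMC_meanAccept hw hδ hst N hsin]
  obtain ⟨S, hS⟩ : ∃ S : ℝ, |Real.sin (N * Real.arccos (1 - δ ^ 2 * (w2 : ℝ) / 2))| = S := ⟨_, rfl⟩
  obtain ⟨sv, hsv⟩ : ∃ sv : ℝ, 1 - δ ^ 2 * (w2 : ℝ) / 4 = sv := ⟨_, rfl⟩
  have hS0 : 0 < S := by rw [← hS]; exact abs_pos.mpr hsin
  have hsv0 : 0 < sv := by rw [← hsv]; nlinarith
  have hsq : Real.sin (N * Real.arccos (1 - δ ^ 2 * (w2 : ℝ) / 2)) ^ 2 = S ^ 2 := by rw [← hS, sq_abs]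
  rw [hsq, hS, hsv]
  set x : ℝ := 8 * Real.sqrt sv / (δ ^ 2 * w2 * S) with hx
  have hx0 : 0 < x := by rw [hx]; positivity
  -- `√(m/2) = 1/x`
  have hroot : Real.sqrt (δ ^ 4 * (w2 : ℝ) ^ 2 * S ^ 2 / (32 * sv) / 2) = x⁻¹ := by
    have hx' : x⁻¹ = δ ^ 2 * w2 * S / (8 * Real.sqrt sv) := by rw [hx, inv_div]
    rw [hx', Real.sqrt_eq_iff_mul_self_eq_of_pos (by positivity)]
    have hr2 : Real.sqrt sv * Real.sqrt sv = sv := Real.mul_self_sqrt hsv0.le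
    field_simp
    nlinarith [hr2]
  rw [hroot, Real.arctan_inv_of_pos hx0]
  field_simp
  ring

/-- **ONE LEAPFROG STEP**: for `N = 1` the law is `ā = (2/π)·arctan(8/(δΩ)³)`
(`sin θ = δΩ√(1 − δ²Ω²/4)`), i.e. `1 − ā ≈ (δΩ)³/(4π)` at small steps. -/
theorem freeModeHMC_meanAccept_one_step (hw : w2 ≠ 0) {δ : ℝ} (hδ : 0 < δ) (hst : δ ^ 2 * (w2 : ℝ) < 4) :
    ∫ z : ℝ × ℝ, min 1 (Real.exp (-(δ ^ 2 * (w2 : ℝ) / 8 * ((lfMode δ w2 z).2 ^ 2 - z.2 ^ 2))))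
        * (gaussianPDFReal 0 w2⁻¹ z.1 * gaussianPDFReal 0 1 z.2) ∂((volume : Measure ℝ).prod volume)
      = 2 / π * Real.arctan (8 / (δ ^ 3 * Real.sqrt w2 ^ 3)) := by
  have hw' : (0 : ℝ) < w2 := by exact_mod_cast pos_iff_ne_zero.mpr hw
  have hsv0 : 0 < 1 - δ ^ 2 * (w2 : ℝ) / 4 := by nlinarith
  -- `sin θ = √(1 − cos²θ) = δ√Ω²·√(1 − δ²Ω²/4) > 0`
  have hsw : Real.sqrt (w2 : ℝ) ^ 2 = w2 := Real.sq_sqrt hw'.le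
  have hss : Real.sqrt (1 - δ ^ 2 * (w2 : ℝ) / 4) ^ 2 = 1 - δ ^ 2 * w2 / 4 := Real.sq_sqrt hsv0.le
  have hsin : Real.sin ((1 : ℕ) * Real.arccos (1 - δ ^ 2 * (w2 : ℝ) / 2))
      = δ * Real.sqrt w2 * Real.sqrt (1 - δ ^ 2 * w2 / 4) := by
    rw [Nat.cast_one, one_mul, Real.sin_arccos,
      show 1 - (1 - δ ^ 2 * (w2 : ℝ) / 2) ^ 2 = (δ * Real.sqrt w2 * Real.sqrt (1 - δ ^ 2 * w2 / 4)) ^ 2 by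
        rw [mul_pow, mul_pow, hsw, hss]; ring]
    exact Real.sqrt_sq (by positivity)
  have hsin0 : Real.sin ((1 : ℕ) * Real.arccos (1 - δ ^ 2 * (w2 : ℝ) / 2)) ≠ 0 := by
    rw [hsin]; positivity
  have h := freeModeHMC_meanAccept hw hδ hst 1 hsin0
  simp only [Function.iterate_one] at h
  rw [h, hsin, abs_of_pos (by positivity)]
  congr 2
  have hr : Real.sqrt (1 - δ ^ 2 * (w2 : ℝ) / 4) ≠ 0 := (Real.sqrt_pos.mpr hsv0).ne'
  rw [show δ ^ 2 * (w2 : ℝ) * (δ * Real.sqrt w2 * Real.sqrt (1 - δ ^ 2 * w2 / 4))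
      = δ ^ 3 * Real.sqrt w2 ^ 3 * Real.sqrt (1 - δ ^ 2 * w2 / 4) by
        rw [show Real.sqrt (w2 : ℝ) ^ 3 = w2 * Real.sqrt w2 by rw [pow_succ, hsw]]; ring,
    mul_div_mul_right _ _ hr]

/-- **RESONANT LENGTHS** (`sin(Nθ) = 0`): the trajectory returns `P_N = ±P`, `ΔH ≡ 0`, and every
proposal is accepted: the integral equals `1`. -/
theorem freeModeHMC_meanAccept_resonant (hw : w2 ≠ 0) {δ : ℝ} (hδ : 0 < δ) (hst : δ ^ 2 * (w2 : ℝ) < 4)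
    (N : ℕ) (hsin : Real.sin (N * Real.arccos (1 - δ ^ 2 * (w2 : ℝ) / 2)) = 0) :
    ∫ z : ℝ × ℝ, min 1 (Real.exp (-(δ ^ 2 * (w2 : ℝ) / 8 * (((lfMode δ w2)^[N] z).2 ^ 2 - z.2 ^ 2))))
        * (gaussianPDFReal 0 w2⁻¹ z.1 * gaussianPDFReal 0 1 z.2) ∂((volume : Measure ℝ).prod volume)
      = 1 := by
  have hw' : (0 : ℝ) < w2 := by exact_mod_cast pos_iff_ne_zero.mpr hw
  have hcos2 : Real.cos (N * Real.arccos (1 - δ ^ 2 * (w2 : ℝ) / 2)) ^ 2 = 1 := by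
    have := Real.sin_sq_add_cos_sq (N * Real.arccos (1 - δ ^ 2 * (w2 : ℝ) / 2))
    rw [hsin] at this; linarith
  have hrot : ∀ z : ℝ × ℝ, ((lfMode δ w2)^[N] z).2 ^ 2 = z.2 ^ 2 := by
    intro z
    have h := congrArg Prod.snd (lfMode_iterate_rotation δ w2 hδ hw' hst z N)
    simp only [hsin] at h
    rw [h]
    simp only [zero_div, neg_zero, zero_mul, zero_add, mul_pow, hcos2, one_mul]
  simp_rw [hrot, sub_self, mul_zero, neg_zero, Real.exp_zero, min_self, one_mul]
  rw [integral_prod_mul (μ := (volume : Measure ℝ)) (ν := (volume : Measure ℝ))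
    (gaussianPDFReal 0 w2⁻¹) (gaussianPDFReal 0 1), integral_gaussianPDFReal_eq_one 0 (inv_ne_zero hw),
    integral_gaussianPDFReal_eq_one 0 one_ne_zero, mul_one]

end ModeHMC

end Summit.Ventures.LatticeQCDFlow.Exactness
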